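import Summits.QuantumFields.BalabanUV.T4Continuum.Spine.NE1p.DressedTerminalWitnessReuse

/-!
# T⁴ programme, spine estimate NE1′ (node O3b/H2) — THE GAUGE QUOTIENT ACTS, part 1 of 3: the raw-rate schedule, abelian lattice
# gauge transformations `U ↦ U + grad g` on `Fld 4 ℂ`, the PLAQUETTE reading with its Stokes identity, and fluctuation atoms with a
# PURE-GAUGE component at the RAW rate `L⁻¹` — on row W7's tower `towerM` UNCHANGED
# (formalisation crew `b2b-balaban-t4-ne1p-formalise-*`, leaf seat 03, generation 4, witness row W15; INTENT CLAIMS.log l.12021)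

Cell `pub-balaban`, sub-cell `t4`, BINDER-OWNERS row NE1′ (owner lineage t4-ne1p-p1; root `Spine/NE1p/DressedRoot.lean`, p211416).
ADDITIVE — imports leaf-02-g4's row W11r part 1 `Spine/NE1p/DressedTerminalWitnessReuse` (p216180: the integer-`L` DATA on W7's tower
and `LW_window`; through it leaf-09's CANONICAL TERMINAL FACE S3l `Spine/NE1p/DressedStabilityOfCanonicalSliceWinSchedules` p215128,
this lineage's rows W7 `DressedTowerWitnessSlice{,End}` p214450 ∕ p214558 (`towerM`, `aM`, `dfW`, `wtM`, `shiftM`, `cM`) and W5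
`DressedTowerWitness{,End}` p213903 ∕ p214143 (`LW`, `flAt`, `defW`, `zeroExp`), leaf-04's `WindowScheduleModWin.geometric` p213785, and
the Literature frame `T4BlockTransport` (`Fld`, `latMove`, `latN`) ∕ `T4BirthChartTransport` (`GaugeInvariant`, `RelGauge`,
`BirthSlice`) ∕ `B8Lemma1Lattice` (`e ν`; the additive plaquette word)) ONLY; modifies nothing.  Part 2 =
`Spine/NE1p/DressedTowerWitnessGaugeBinders.lean` (carried functionals, `hinv` by Stokes, `hpairx` through the quotient, the other
function-level binders); part 3 = `Spine/NE1p/DressedTowerWitnessGaugeEnd.lean` (S3l's three theorems BY NAME; the decided SEPARATION).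

WHY (typer R-T61 (ii), WITNESS SATURATION NOTICE, exception clause «a binder none of these exercises genuinely», named with file and
line in the INTENT l.12021).  In EVERY function-level END instantiation of the crew — 21 instantiations in 15 files, rows W1 W2 W5 W5c
W6 W7 W7c W9 W10 W11 W11r W12 W13 — the gauge relation is `rel := fun … U U' => U = U'`.  Hence the F-9 binder **`hinv`**
(`DressedStabilityOfCanonicalSliceWinSchedules.lean` l.236, `GaugeInvariant ((rel a K) b k' k) ((Fn a K) b k' k)`) is everywhere
inhabited by `fun _ _ h => h ▸ rfl`, and in the `rel` slots of **`hpairx`** (l.231–235), **`hne`** (l.243–246) and **`hsup`** (l.247–250)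
`RelGauge Eq latMove latN U₀ U₁ δ` is the RAW chart distance `‖U₁ − U₀‖_sup ≤ δ`.  The GAUGE QUOTIENT — the mechanism by which the
(I4′) defect of a fresh pair is the TRANSVERSE one, at the transport rate `ψ = L⁻²`, and not the raw birth-chart displacement at the
rate `L⁻¹` (`T4BirthChartTransport` §1: «the RAW birth-chart rate `L⁻¹` per order», `toy_relGauge`: «the gauge quotient in
miniature»; referee caveat k3: F-6's transverse rate is LOAD-BEARING) — was exercised by NO witness at any level of the END chain.
THIS ROW builds function-level data on which it is exercised (part 2) and NECESSARY (part 3, `raw_profile_not_Kfree`).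

THE DATA OF THIS PART (W7's booking `BM K`, trajectory `TM K`, amplitudes `aM K`, weights `wtM`, dressing `shiftM` UNCHANGED):
* §1 THE RAW-RATE SCHEDULE `Wr := WindowScheduleModWin.geometric 1 1 θ (θ∕8) ½ 0`, `θ := LW⁻¹` (the raw rate; `ψ = θ²`): fluctuation
  radii `σ k = θ^{k+1}∕8`, chart windows `wc k = θ^{k+1}∕4`, chart radii `ϱc k = θ^{k+1}∕2` (ratio `2σ = ½ϱc`, W5's `κ = ½`), margins
  `ϱ₁ k = θ^k∕2`, windows `ρw k = c_Wr θ^k` with `c_Wr ≤ 1 ≤ c_M` — so W7's generation sizes `a_K·(c_M + 3)` still dominate the birth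
  slices, and W7's (I4′) numbers `δf = ψ^{k+1}∕4`, `defect = ψ^{k+1}∕2` sit inside the raw-rate windows (`hδfwkR`, `hdefwkR`; the rate
  gap `16ψ^{k+1} ≤ θ^{k+1}`).  Cutoff-free; every datum geometric (LF-3: summable).
* §2 ABELIAN LATTICE GAUGE STRUCTURE on `Fld 4 ℂ`: pure gauges `grad g x ν = g (x + e ν) − g x`, the origin plaquette circulation
  `plq U = U⟨0,e₀⟩ + U⟨e₀,e₀+e₁⟩ − U⟨e₁,e₁+e₀⟩ − U⟨0,e₁⟩` (the word of `B8Lemma1Lattice.plaq` at `(0; 0, 1)` on `ℂ`-valued fields),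
  DISCRETE STOKES `plq (grad g) = 0`, the reading `rd U = ¼·plq U` (operator norm `≤ 1` for the sup norm), the plaquette pattern
  `plqPat` (`‖·‖_sup ≤ 1`, `rd plqPat = 1`), and THE MECHANISM `gaugeInvariant_of_rd`: every functional of the reading is
  `GaugeInvariant (fun U V => ∃ g, V = U + grad g)`.  The gauge relation is SPELLED INLINE everywhere — no `def … : Prop`.
* §3 THE FLUCTUATION ATOMS `atomG k := δf_k·plqPat + grad (gpot k)`, `gpot k = (σ k∕2)·δ_0`: a transverse part reading W7's
  `δf_k = ψ^{k+1}∕4` EXACTLY (`rd_atomG`) plus a PURE GAUGE of sup size `gsz k = θ^{k+1}∕16` (the raw rate), inside `bondBall (σ k)`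
  (`atomG_mem`); at the bond `⟨0, e₃⟩` the atom IS pure gauge of modulus `gsz k` (`norm_atomG_gaugeBond`), the RAW size of the
  fresh pair, sixteen-fold the transverse defect at least (`dfW_lt_gsz`).

DECLARED ≡ 0 (as in W7∕W11r; live elsewhere): `𝒜 ≡ 0`, `s ≡ 0` (W9∕W12), `creg ≡ 0` (W10), `Sabs ≡ ∅` (W13), `ref = id`, one family
at the zero block (W14).  WHAT IT IS NOT (typer R-T64 (i)(f), k2∕k3).  An ABELIAN toy (additive gauge action `U ↦ U + grad g` over the
chart's scalars) exercising the SHAPE of F-9's gauge quotient — it does NOT model Bałaban's non-abelian relative axial gauge, asserts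
no commutation identity, and F-6's rate stays a displayed wall (`t4/CITED-FACTS-T4.md` §2∕§4); `Lb` is the toy's integer, NOT
Bałaban's `L` (no numeral from print); not an estimate; nothing of Bałaban's densities, gauges or propagators is modelled or asserted
([Balaban1985Averaging] (44)–(47), [Balaban1987RG1] (1.19)∕(3.37) are CONTEXT carried by the imported headers only); no
`def … : Prop`; [folklore] toy kernel mathematics, 0 sorry, 0 citations used as facts.  FILES (booking R-T64 (i)(a) named two; the
data + dischargers exceed the 400-line cap as one file, so they are parts 1–2 and the face is part 3 — declared deviation, W13's
three-file pattern).  Headline (c4): «the gauge quotient acts: `hinv` by discrete Stokes, `hpairx` by gauging away a raw-rate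
pure-gauge component; raw reading not K-free, quotient reading K-free at `c_δ = ½`; the canonical terminal face fires at integer `Lb`
on a decided abelian toy; nothing of Bałaban's densities; NE1′ NOT proved».

HONEST FRAMING.  Rung (B)+1 bookkeeping on ONE finite four-torus of fixed physical size — NOT infinite volume, NOT a mass gap, NOT OS
on ℝ⁴, NOT the Clay problem, NOT summit progress.  NE1′ is NOT PRINTED and NOT PROVED; every headline reads «NE1′ ⇐ the named
binders»; spine PROVED 0∕9 unchanged.  HONEST DEPENDENCY: continuum YM on T⁴ ⇐ BetaPertH ∧ nine spine estimates (0/9 proved);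
BetaPertH ⇐ (D1) ∧ (D4) ∧ CAP+tail; G-an2-4 gates asym, D1 and NE2/3/4.
-/

noncomputable section

namespace Summit.QuantumFields.BalabanUV.T4Continuum.NE1p.DressedTowerWitnessGauge


open MeasureTheory Set Metric Filter Finset
open scoped BigOperators
open Literature.MathematicalPhysics.QuantumFieldTheory.Balaban1983to89
open Literature.MathematicalPhysics.QuantumFieldTheory.Balaban1983to89.T4TermFormat
open Literature.MathematicalPhysics.QuantumFieldTheory.Balaban1983to89.T4TermFormat.Booking
open Literature.MathematicalPhysics.QuantumFieldTheory.Balaban1983to89.T4GatedBooking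
open Literature.MathematicalPhysics.QuantumFieldTheory.Balaban1983to89.T4TrajectoryComparison
open B8Lemma1Lattice (e)
open T4TrajectoryModulus (bondBall bondBall_add_mem bondBall_latMove_add_mem bondBall_diam)
open T4BlockTransport (Fld NDir latMove latN Site norm_dir_le)
open T4BirthChartTransport (GaugeInvariant BirthSlice RelGauge)
open T4TrajectoryDensity
open Summit.QuantumFields.BalabanUV.T4Continuum.T4TrajectoryDensityDressed
open Summit.QuantumFields.BalabanUV.T4Continuum.T4TrajectoryDensityWitness
open Summit.QuantumFields.BalabanUV.T4Continuum.NE1p.DressedRoot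
open Summit.QuantumFields.BalabanUV.T4Continuum.NE1p.DressedUniformConstants
open Summit.QuantumFields.BalabanUV.T4Continuum.NE1p.DressedWindowScheduleWin
open Summit.QuantumFields.BalabanUV.T4Continuum.NE1p.DressedWindowScheduleModWin
open Summit.QuantumFields.BalabanUV.T4Continuum.NE1p.DressedTowerWitness
open Summit.QuantumFields.BalabanUV.T4Continuum.NE1p.DressedTowerWitnessSlice
open Summit.QuantumFields.BalabanUV.T4Continuum.NE1p.DressedTerminalWitnessReuse

/-! ## §1 The raw rate `θ = L⁻¹` and the raw-rate schedule `Wr` [decided toy] -/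

/-- [arith] [folklore] The raw rate `θ = LW⁻¹` is positive. -/
theorem theta_pos : 0 < LW⁻¹ := inv_pos.mpr LW_pos

/-- [arith] [folklore] `θ ≤ 1∕120` (`120 < LW`, W11r's `LW_window`). -/
theorem theta_le : LW⁻¹ ≤ 1 / 120 := by
  rw [inv_eq_one_div]
  exact one_div_le_one_div_of_le (by norm_num) LW_window.1.le

/-- [arith] [folklore] `θ < 1`. -/
theorem theta_lt_one : LW⁻¹ < 1 := theta_le.trans_lt (by norm_num)

/-- [arith] [folklore] The transverse rate is the square of the raw rate: `ψ = θ²`. -/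
theorem psi_eq_theta_sq : (LW ^ 2)⁻¹ = LW⁻¹ * LW⁻¹ := by rw [sq, mul_inv]

/-- [arith] [folklore] `ψ^n = θ^n·θ^n`. -/
theorem psi_pow (n : ℕ) : ((LW ^ 2)⁻¹) ^ n = (LW⁻¹) ^ n * (LW⁻¹) ^ n := by rw [psi_eq_theta_sq, mul_pow]

/-- [arith] [folklore] THE RATE GAP: `16·ψ^{k+1} ≤ θ^{k+1}` (indeed `120·ψ^{k+1} ≤ θ^{k+1}`) — a transverse-size datum is far inside a
raw-size window of the same step. -/
theorem sixteen_psi_pow_le (k : ℕ) : 16 * ((LW ^ 2)⁻¹) ^ (k + 1) ≤ (LW⁻¹) ^ (k + 1) := by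
  rw [psi_pow]
  have h0 : 0 ≤ (LW⁻¹) ^ (k + 1) := pow_nonneg theta_pos.le _
  have h1 : (LW⁻¹) ^ (k + 1) ≤ LW⁻¹ := by
    rw [pow_succ]
    exact mul_le_of_le_one_left theta_pos.le (pow_le_one₀ theta_pos.le theta_lt_one.le)
  have h2 : (LW⁻¹) ^ (k + 1) ≤ 1 / 120 := h1.trans theta_le
  nlinarith

/-- **THE RAW-RATE SCHEDULE** [decided toy]: leaf-04's `WindowScheduleModWin.geometric` with ratio `θ = LW⁻¹`, fluctuation scale
`σ₀ = θ∕8`, radius scale `ϱ₀ = ½ ≤ r = 1`, final window `0`, slice window `w = 1`.  Cutoff-free. [folklore] -/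
def Wr : WindowScheduleModWin 1 1 :=
  WindowScheduleModWin.geometric 1 1 (LW⁻¹) (LW⁻¹ / 8) (1 / 2) 0 theta_pos theta_lt_one (by have := theta_pos; positivity)
    (by have := theta_lt_one; linarith) (by norm_num) (by norm_num)

/-- The birth-window radius `c_Wr = ((1 + 2θ)·θ∕8 + ½)∕(1 − θ)` (cutoff-free). [folklore] -/
def cWr : ℝ := ((1 + 2 * LW⁻¹) * (LW⁻¹ / 8) + 1 / 2) / (1 - LW⁻¹)

/-- [arith] [folklore] The schedule's fields, unfolded. -/
theorem Wr_ρw (k : ℕ) : Wr.ρw k = cWr * (LW⁻¹) ^ k := by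
  show 0 + ((1 + 2 * LW⁻¹) * (LW⁻¹ / 8) + 1 / 2) / (1 - LW⁻¹) * (LW⁻¹) ^ k = _
  rw [zero_add]; rfl

/-- [arith] [folklore] -/ theorem Wr_σ (k : ℕ) : Wr.σ k = LW⁻¹ / 8 * (LW⁻¹) ^ k := rfl
/-- [arith] [folklore] -/ theorem Wr_ϱc (k : ℕ) : Wr.ϱc k = 1 / 2 * (LW⁻¹) ^ (k + 1) := rfl
/-- [arith] [folklore] -/ theorem Wr_wc (k : ℕ) : Wr.wc k = 2 * (LW⁻¹ / 8) * (LW⁻¹) ^ k := rfl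
/-- [arith] [folklore] -/ theorem Wr_ϱ₁ (k : ℕ) : Wr.ϱ₁ k = 1 / 2 * (LW⁻¹) ^ k := rfl

/-- [arith] [folklore] `σ k = θ^{k+1}∕8`. -/
theorem Wr_σ' (k : ℕ) : Wr.σ k = (LW⁻¹) ^ (k + 1) / 8 := by rw [Wr_σ, pow_succ]; ring

/-- [arith] [folklore] `wc k = θ^{k+1}∕4`. -/
theorem Wr_wc' (k : ℕ) : Wr.wc k = (LW⁻¹) ^ (k + 1) / 4 := by rw [Wr_wc, pow_succ]; ring

/-- [arith] [folklore] `0 < c_Wr ≤ 1`. -/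
theorem cWr_pos : 0 < cWr := by
  have h1 := theta_pos; have h2 := theta_lt_one
  unfold cWr
  exact div_pos (by positivity) (by linarith)

/-- [arith] [folklore] -/
theorem cWr_le_one : cWr ≤ 1 := by
  have h1 := theta_pos; have h2 := theta_le
  unfold cWr
  rw [div_le_one (by linarith)]
  nlinarith

/-- [arith] [folklore] W7's birth window dominates: `1 ≤ c_M` (`c_M = (… + 1)∕(1 − ψ)`). -/
theorem one_le_cM : 1 ≤ cM := by
  have h1 := psi_pos; have h2 := psi_lt_one
  unfold cM
  rw [le_div_iff₀ (by linarith)]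
  nlinarith

/-- [arith] [folklore] Every raw-rate window lies inside W7's birth window `bondBall c_M`: `ρw k ≤ c_Wr ≤ 1 ≤ c_M`. -/
theorem Wr_ρw_le_cM (k : ℕ) : Wr.ρw k ≤ cM := by
  rw [Wr_ρw]
  have h : cWr * (LW⁻¹) ^ k ≤ cWr * 1 :=
    mul_le_mul_of_nonneg_left (pow_le_one₀ theta_pos.le theta_lt_one.le) cWr_pos.le
  linarith [cWr_le_one, one_le_cM]

/-- [folklore] The zero background lies in every window of the raw-rate schedule. -/
theorem zero_mem_windowR (k : ℕ) : (0 : Fld 4 ℂ) ∈ (bondBall 4 (Wr.ρw k) : Set (Fld 4 ℂ)) :=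
  WindowScheduleModWin.geometric_zero_mem_window (r := 1) theta_pos theta_lt_one (by have := theta_pos; positivity)
    (by have := theta_lt_one; linarith) (by norm_num) (by norm_num) le_rfl k

/-- **THE SCHEDULE's K-FREE RATIO** `2σ k = θ^{k+1}∕4 = ½·ϱc k` — W5's `κ = ½`, so W11r's located scalars serve unchanged. [folklore] -/
theorem hratioR : ∀ k, 2 * Wr.σ k ≤ 1 / 2 * Wr.ϱc k := fun k => by
  rw [Wr_σ, Wr_ϱc, pow_succ]; exact le_of_eq (by ring)

/-- [arith] [folklore] W7's fresh defect `δf_k = ψ^{k+1}∕4` is at most `θ^{k+1}∕64` — an eighth of the raw-rate fluctuation radius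
`σ k = θ^{k+1}∕8`, so at most half of `σ k ∕ 2` … -/
theorem dfW_le_sigma_half (k : ℕ) : dfW k ≤ Wr.σ k / 2 := by
  rw [Wr_σ']; unfold dfW
  have := sixteen_psi_pow_le k
  have h0 : 0 ≤ ((LW ^ 2)⁻¹) ^ (k + 1) := pow_nonneg psi_pos.le _
  linarith

/-- [arith] [folklore] … and inside the chart window: `hδfwk` on the raw-rate schedule. -/
theorem hδfwkR (k : ℕ) : dfW k ≤ Wr.wc k := by
  have h := dfW_le_sigma_half k
  have hσ := Wr.hσwc k
  have hσ0 := (Wr.hσ k).le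
  linarith

/-- [arith] [folklore] `hdefwk` on the raw-rate schedule: W5's transverse defect `ψ^{k+1}∕2 = 2δf_k ≤ wc k`. -/
theorem hdefwkR (k : ℕ) : defW (k + 1) ≤ Wr.wc k := by
  have h : defW (k + 1) = 2 * dfW k := by unfold defW dfW; ring
  rw [h, Wr_wc']
  have := sixteen_psi_pow_le k
  have h0 : 0 ≤ ((LW ^ 2)⁻¹) ^ (k + 1) := pow_nonneg psi_pos.le _
  unfold dfW
  linarith

/-! ## §2 Abelian lattice gauge structure on `Fld 4 ℂ`: pure gauges, the origin plaquette, Stokes [folklore] -/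

/-- THE PURE GAUGES: the lattice gradient of a site function, `(grad g)⟨x, x+e_ν⟩ = g(x + e_ν) − g(x)` (the abelian ∕ Lie-algebra
model of `U ↦ g(x)·U⟨x,x+e_ν⟩·g(x+e_ν)⁻¹`). [folklore] -/
def grad (g : Site 4 → ℂ) : Fld 4 ℂ := fun x ν => g (x + e ν) - g x

/-- [folklore] The constant-zero potential is no gauge at all. -/
@[simp] theorem grad_zeroFn : grad (fun _ : Site 4 => (0 : ℂ)) = 0 := by funext x ν; simp [grad]
/-- [folklore] Reversing a potential reverses its pure gauge. -/
theorem grad_negFn (g : Site 4 → ℂ) : grad (-g) = -grad g := by funext x ν; simp [grad]; ring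

/-- THE ORIGIN PLAQUETTE CIRCULATION of a `ℂ`-valued bond field: `U⟨0,e₀⟩ + U⟨e₀,e₀+e₁⟩ − U⟨e₁,e₁+e₀⟩ − U⟨0,e₁⟩` — the word of
`B8Lemma1Lattice.plaq` at the plaquette `(0; 0, 1)`. [folklore] -/
def plq (U : Fld 4 ℂ) : ℂ := U 0 0 + U (e 0) 1 - U (e 1) 0 - U 0 1

/-- [folklore] -/ @[simp] theorem plq_zero : plq (0 : Fld 4 ℂ) = 0 := by simp [plq]
/-- [folklore] -/ @[simp] theorem plq_add (U V : Fld 4 ℂ) : plq (U + V) = plq U + plq V := by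
  simp only [plq, Pi.add_apply]; ring
/-- [folklore] -/ @[simp] theorem plq_neg (U : Fld 4 ℂ) : plq (-U) = -plq U := by
  simp only [plq, Pi.neg_apply]; ring
/-- [folklore] -/ @[simp] theorem plq_smul (c : ℂ) (U : Fld 4 ℂ) : plq (c • U) = c * plq U := by
  simp only [plq, Pi.smul_apply, smul_eq_mul]; ring
/-- [folklore] The chart moves the plaquette circulation affinely. -/
theorem plq_latMove (U : Fld 4 ℂ) (p : NDir 4 ℂ) (t : ℂ) : plq (latMove U p t) = plq U + t * plq p.1.1 := by
  simp only [plq, latMove, smul_eq_mul]; ring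

/-- **DISCRETE STOKES**: a pure gauge has no plaquette circulation. [folklore] -/
@[simp] theorem plq_grad (g : Site 4 → ℂ) : plq (grad g) = 0 := by
  simp only [plq, grad, zero_add]
  rw [add_comm (e 1) (e 0)]
  ring

/-- [folklore] The plaquette circulation is dominated by four bond values. -/
theorem norm_plq_le {U : Fld 4 ℂ} {ρ : ℝ} (hU : ∀ x ν, ‖U x ν‖ ≤ ρ) : ‖plq U‖ ≤ 4 * ρ := by
  unfold plq
  have h1 := hU 0 0; have h2 := hU (e 0) 1; have h3 := hU (e 1) 0; have h4 := hU 0 1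
  calc ‖U 0 0 + U (e 0) 1 - U (e 1) 0 - U 0 1‖
      ≤ ‖U 0 0 + U (e 0) 1 - U (e 1) 0‖ + ‖U 0 1‖ := norm_sub_le _ _
    _ ≤ ‖U 0 0 + U (e 0) 1‖ + ‖U (e 1) 0‖ + ‖U 0 1‖ := by linarith [norm_sub_le (U 0 0 + U (e 0) 1) (U (e 1) 0)]
    _ ≤ ‖U 0 0‖ + ‖U (e 0) 1‖ + ‖U (e 1) 0‖ + ‖U 0 1‖ := by linarith [norm_add_le (U 0 0) (U (e 0) 1)]
    _ ≤ 4 * ρ := by linarith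

/-- THE READING of the carried functionals: a quarter of the origin plaquette circulation (operator norm `≤ 1` w.r.t. the sup
norm, like W7's `U₀₀`). [folklore] -/
def rd (U : Fld 4 ℂ) : ℂ := ((1 / 4 : ℝ) : ℂ) * plq U

/-- [folklore] -/ @[simp] theorem rd_zero : rd (0 : Fld 4 ℂ) = 0 := by simp [rd]
/-- [folklore] -/ @[simp] theorem rd_add (U V : Fld 4 ℂ) : rd (U + V) = rd U + rd V := by simp [rd]; ring
/-- [folklore] -/ @[simp] theorem rd_smul (c : ℂ) (U : Fld 4 ℂ) : rd (c • U) = c * rd U := by simp [rd]; ring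
/-- [folklore] **The reading is gauge invariant** (Stokes). -/
@[simp] theorem rd_grad (g : Site 4 → ℂ) : rd (grad g) = 0 := by simp [rd]
/-- [folklore] -/
theorem rd_latMove (U : Fld 4 ℂ) (p : NDir 4 ℂ) (t : ℂ) : rd (latMove U p t) = rd U + t * rd p.1.1 := by
  simp only [rd, plq_latMove]; ring

/-- [folklore] On `bondBall ρ` the reading has modulus `≤ ρ`. -/
theorem norm_rd_le {U : Fld 4 ℂ} {ρ : ℝ} (hU : ∀ x ν, ‖U x ν‖ ≤ ρ) : ‖rd U‖ ≤ ρ := by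
  unfold rd
  rw [norm_mul, Complex.norm_real, Real.norm_eq_abs, abs_of_pos (by norm_num : (0 : ℝ) < 1 / 4)]
  have := norm_plq_le hU
  linarith

/-- [folklore] The reading of a declared direction is within its declared bound. -/
theorem norm_rd_dir_le (p : NDir 4 ℂ) : ‖rd p.1.1‖ ≤ latN p := norm_rd_le (norm_dir_le p)

/-- [folklore] On the disc of radius `c∕N` the chart displacement of the reading is at most `c`. -/
theorem norm_t_rd_le {c : ℝ} (p : NDir 4 ℂ) (hp : 0 < latN p) {t : ℂ} (ht : t ∈ ball (0 : ℂ) (c / latN p)) :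
    ‖t * rd p.1.1‖ ≤ c := by
  rw [mem_ball, dist_zero_right] at ht
  rw [norm_mul]
  calc ‖t‖ * ‖rd p.1.1‖ ≤ (c / latN p) * latN p :=
        mul_le_mul ht.le (norm_rd_dir_le p) (norm_nonneg _) ((norm_nonneg t).trans ht.le)
    _ = c := div_mul_cancel₀ _ hp.ne'

/-- [folklore] Unit site vectors of `ℤ⁴` are non-zero. -/
theorem unitSite_ne_zero (ν : Fin 4) : ¬ (e ν : Site 4) = 0 := fun h => by simpa [e] using congr_fun h ν

/-- [folklore] -/
theorem zero_ne_unitSite (ν : Fin 4) : ¬ (0 : Site 4) = e ν := fun h => unitSite_ne_zero ν h.symm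

/-- [folklore] A bond's far endpoint is not its near endpoint. -/
theorem add_unitSite_ne (x : Site 4) (ν : Fin 4) : ¬ x + e ν = x := fun h => unitSite_ne_zero ν (by simpa using h)

/-- THE PLAQUETTE PATTERN: `+1` on `⟨0,e₀⟩`, `⟨e₀,e₀+e₁⟩`, `−1` on `⟨e₁,e₁+e₀⟩`, `⟨0,e₁⟩`, `0` elsewhere (sup norm `≤ 1`,
circulation `4`). [folklore] -/
def plqPat : Fld 4 ℂ := fun x ν =>
  if x = 0 ∧ ν = 0 then 1 else if x = e 0 ∧ ν = 1 then 1 else if x = e 1 ∧ ν = 0 then -1 else if x = 0 ∧ ν = 1 then -1 else 0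

/-- [folklore] -/
theorem norm_plqPat_le (x : Site 4) (ν : Fin 4) : ‖plqPat x ν‖ ≤ 1 := by
  unfold plqPat; split_ifs <;> simp

/-- [folklore] The pattern's circulation is `4`. -/
theorem plq_plqPat : plq plqPat = 4 := by
  have h1 : plqPat 0 0 = 1 := by simp [plqPat]
  have h2 : plqPat (e 0) 1 = 1 := by simp [plqPat]
  have h3 : plqPat (e 1) 0 = -1 := by simp [plqPat, unitSite_ne_zero]
  have h4 : plqPat 0 1 = -1 := by simp [plqPat, zero_ne_unitSite]
  simp only [plq, h1, h2, h3, h4]; norm_num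

/-- [folklore] The pattern reads `1`. -/
@[simp] theorem rd_plqPat : rd plqPat = 1 := by
  rw [rd, plq_plqPat]; push_cast; norm_num

/-- [folklore] Away from the directions `0, 1` the pattern vanishes — in particular on every bond `⟨x, x+e₃⟩`. -/
@[simp] theorem plqPat_three (x : Site 4) : plqPat x 3 = 0 := by
  simp [plqPat]

/-- **THE MECHANISM** [folklore]: any functional factoring through the reading is invariant under the abelian gauge relation
`V = U + grad g` — by Stokes, not by `rfl`. -/
theorem gaugeInvariant_of_rd {E : Type*} (F : ℂ → E) :
    GaugeInvariant (fun U V : Fld 4 ℂ => ∃ g : Site 4 → ℂ, V = U + grad g) (fun U => F (rd U)) := by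
  rintro U V ⟨g, rfl⟩
  simp

/-! ## §3 The fluctuation atoms: transverse part at the rate `ψ`, pure-gauge part at the raw rate `θ` [decided toy] -/

/-- The pure-gauge amplitude of step `k`: half the fluctuation radius, `θ^{k+1}∕16`. [folklore] -/
def gsz (k : ℕ) : ℝ := Wr.σ k / 2

/-- [arith] [folklore] -/ theorem gsz_pos (k : ℕ) : 0 < gsz k := by unfold gsz; exact half_pos (Wr.hσ k)
/-- [arith] [folklore] -/ theorem gsz_eq (k : ℕ) : gsz k = (LW⁻¹) ^ (k + 1) / 16 := by rw [gsz, Wr_σ']; ring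

/-- The gauge potential of step `k`: `gsz k` at the origin, `0` elsewhere. [folklore] -/
def gpot (k : ℕ) : Site 4 → ℂ := fun x => if x = 0 then ((gsz k : ℝ) : ℂ) else 0

/-- The transverse part of the atom: W7's fresh defect on the plaquette pattern (reading `δf_k`, sup norm `δf_k`). [folklore] -/
def trv (k : ℕ) : Fld 4 ℂ := ((dfW k : ℝ) : ℂ) • plqPat

/-- **THE SECOND ATOM OF STEP `k`**: transverse part plus the pure gauge `grad (gpot k)`. [folklore] -/
def atomG (k : ℕ) : Fld 4 ℂ := trv k + grad (gpot k)

/-- [folklore] The transverse part reads W7's fresh defect EXACTLY. -/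
@[simp] theorem rd_trv (k : ℕ) : rd (trv k) = ((dfW k : ℝ) : ℂ) := by rw [trv, rd_smul, rd_plqPat, mul_one]

/-- [folklore] **The atom reads W7's fresh defect** — the pure-gauge part is invisible to the reading (Stokes). -/
@[simp] theorem rd_atomG (k : ℕ) : rd (atomG k) = ((dfW k : ℝ) : ℂ) := by rw [atomG, rd_add, rd_trv, rd_grad, add_zero]

/-- [folklore] The transverse part is bounded bond-wise by `δf_k`. -/
theorem norm_trv_le (k : ℕ) (x : Site 4) (ν : Fin 4) : ‖trv k x ν‖ ≤ dfW k := by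
  simp only [trv, Pi.smul_apply, smul_eq_mul, norm_mul, Complex.norm_real, Real.norm_eq_abs, abs_of_pos (dfW_pos k)]
  exact mul_le_of_le_one_right (dfW_pos k).le (norm_plqPat_le x ν)

/-- [folklore] The pure gauge is bounded bond-wise by its amplitude (a bond never has both endpoints at the origin). -/
theorem norm_grad_gpot_le (k : ℕ) (x : Site 4) (ν : Fin 4) : ‖grad (gpot k) x ν‖ ≤ gsz k := by
  have hg : 0 < gsz k := gsz_pos k
  simp only [grad, gpot]
  by_cases hx : x = 0
  · subst hx
    simp [zero_add, unitSite_ne_zero, Complex.norm_real, abs_of_pos hg]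
  · by_cases hx' : x + e ν = 0
    · simp [hx, hx', Complex.norm_real, abs_of_pos hg]
    · simp [hx, hx', hg.le]

/-- [folklore] **`hDμ` for the atom**: `‖atomG k‖_sup ≤ δf_k + gsz k ≤ σ k` — the atom lies in the step's fluctuation ball (the
transverse part takes at most an eighth of it, the pure gauge exactly a half). -/
theorem atomG_mem (k : ℕ) : atomG k ∈ (bondBall 4 (Wr.σ k) : Set (Fld 4 ℂ)) := fun x ν => by
  have h1 := norm_trv_le k x ν
  have h2 := norm_grad_gpot_le k x ν
  have h3 := dfW_le_sigma_half k
  calc ‖atomG k x ν‖ = ‖trv k x ν + grad (gpot k) x ν‖ := rfl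
    _ ≤ ‖trv k x ν‖ + ‖grad (gpot k) x ν‖ := norm_add_le _ _
    _ ≤ Wr.σ k := by unfold gsz at h2; linarith

/-- [folklore] **At the bond `⟨0, e₃⟩` the atom IS pure gauge**, of modulus `gsz k = θ^{k+1}∕16` — the RAW size of the fluctuation. -/
theorem norm_atomG_gaugeBond (k : ℕ) : ‖atomG k 0 3‖ = gsz k := by
  have hg : 0 < gsz k := gsz_pos k
  have h : atomG k 0 3 = -(((gsz k : ℝ) : ℂ)) := by
    simp only [atomG, Pi.add_apply, trv, Pi.smul_apply, plqPat_three, smul_zero, zero_add, grad, gpot, zero_add,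
      if_neg (unitSite_ne_zero 3), ↓reduceIte, zero_sub]
  rw [h, norm_neg, Complex.norm_real, Real.norm_eq_abs, abs_of_pos hg]

/-- [folklore] The RAW sup size of the fresh pair exceeds the transverse defect: `δf_k < gsz k` (indeed `4·δf_k ≤ gsz k` by the rate
gap; the true ratio `gsz k ∕ δf_k = (4θ^{k+1})⁻¹` is `≥ 30` and grows geometrically). -/
theorem dfW_lt_gsz (k : ℕ) : dfW k < gsz k := by
  rw [gsz_eq]; unfold dfW
  have := sixteen_psi_pow_le k
  have h0 : 0 < (LW⁻¹) ^ (k + 1) := pow_pos theta_pos _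
  linarith

end Summit.QuantumFields.BalabanUV.T4Continuum.NE1p.DressedTowerWitnessGauge

end
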